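import Literature.Geometry.Symplectic.CircleQuotientForms
import Literature.Geometry.Manifold.FreeCircleBundle
import HarnessLib

/-!
# Closed horizontal `2`-forms are basic for a free circle action (`ℒ_X α = 0` without Cartan)

Fifth proofs companion of `OrigamiUnfolding.lean` (fact seat of
`Literature.Geometry.Symplectic.exists_symplecticCutPieces_of_isOrigamiForm`), completing the
form-level half of step (S2) of the unfolding (Cannas da Silva–Guillemin–Pires, *Symplectic
Origami*, Def. 2.2 and proof of Prop. 2.8: "`i*ω = π*ω_B`"): the tree's `IsOrigamiForm` records
that the orbits of the circle action on the fold are tangent to `ker ω` (horizontality of `i*ω`)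
but not that `i*ω` is invariant; classically invariance follows from Cartan's formula
`ℒ_X = d ι_X + ι_X d`. Here it is proved for any free smooth circle action on a Hausdorff manifold
`N` (modelled on `ℝᵐ`) and any closed smooth `2`-form `α` with `ι_X α = 0`, WITHOUT Cartan's
formula, through the flat trivialisation of a slice (`FreeCircleBundle.lean`):

* `mfderiv_circleOrbit_apply_one` — the orbit velocity at time `t₀` is the fundamental vector
  `circleFundVec` at the point reached;
* `sliceTrivR d (u, t) = exp t • param u` on `sliceDomR d = dom × ℝ` (flat model
  `𝓘(ℝ, F × ℝ)`): `contMDiffOn_sliceTrivR`, `smul_sliceTrivR` (equivariance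
  `exp s • sliceTrivR (u, t) = sliceTrivR (u, t + s)`), `mfderiv_sliceTrivR_inr`
  (`∂_t sliceTrivR = X ∘ sliceTrivR`);
* for `β = sliceTrivR^* α` on the flat space: `pullback_sliceTrivR_apply_inr_left/right`
  (`ι_{∂_t} β = 0`), `extDeriv_pullback_sliceTrivR` (`dβ = 0`, naturality
  `mextDeriv_pullback_apply` + `mextDeriv_eq_extDeriv`), whence by Mathlib's `extDeriv_apply`
  **`fderiv_pullback_sliceTrivR_apply_inr`**: `∂_t β(w₁, w₂) = 0`
  (`0 = dβ(∂_t, w₁, w₂) = ∂_t β(w₁,w₂) - ∂_{w₁} β(∂_t,w₂) + ∂_{w₂} β(∂_t,w₁)`), and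
  `pullback_sliceTrivR_apply_eq`: the coefficients of `β` do not depend on `t`;
* `sliceSecR`, `sliceTrivR_sliceSecR` (a smooth local section of `sliceTrivR`),
  `apply_smul_sliceTrivR_eq` and **`isCircleBasicForm_of_horizontal`**: a closed smooth
  horizontal `2`-form is `IsCircleBasicForm` (invariant), hence descends to the orbit manifold
  (`CircleQuotientForms.lean`).

Everything here is proved; the definitions are concrete; no facts.

## References

* A. Cannas da Silva, V. Guillemin, A. R. Pires, *Symplectic Origami*, IMRN 2011 =
  arXiv:0909.4065, Def. 2.2, proof of Prop. 2.8. [CannasdasilvaGuilleminPires2010]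
* J. M. Lee, *Introduction to Smooth Manifolds*, 2nd ed. (2012), Thm. 21.10, Prop. 12.32 ff.
  (Lie derivatives of forms; here circumvented). [LeeSmoothManifolds2013]
-/

noncomputable section

open scoped Manifold ContDiff Topology
open Set Function Module Filter
open Literature.Geometry.Kaehler Literature.Geometry.Manifold

namespace Literature.Geometry.Symplectic

section OrbitVelocity

variable {m : ℕ} {N : Type*} [TopologicalSpace N] [ChartedSpace (EuclideanSpace ℝ (Fin m)) N]
  [MulAction Circle N]

/-- **The velocity of an orbit at time `t₀` is the fundamental vector at the point reached**:
`d/dt|_{t₀} exp t • y = X (exp t₀ • y)` (group law `exp t • y = exp (t - t₀) • (exp t₀ • y)`).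
[folklore] -/
theorem mfderiv_circleOrbit_apply_one
    (hθ : ContMDiff ((𝓡 1).prod (𝓡 m)) (𝓡 m) ∞ (fun x : Circle × N => x.1 • x.2)) (y : N)
    (t₀ : ℝ) :
    mfderiv 𝓘(ℝ, ℝ) (𝓡 m) (fun t : ℝ => Circle.exp t • y) t₀ (1 : ℝ) =
      circleFundVec (Circle.exp t₀ • y) := by
  have hγ : ContMDiff 𝓘(ℝ, ℝ) (𝓡 m) ∞ (fun t : ℝ => Circle.exp t • (Circle.exp t₀ • y)) :=
    contMDiff_circleOrbit (θ := fun (a : Circle) (x : N) => a • x) hθ _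
  have hA : HasMFDerivAt 𝓘(ℝ, ℝ) 𝓘(ℝ, ℝ) (fun t : ℝ => t - t₀) t₀
      (ContinuousLinearMap.id ℝ ℝ) :=
    hasMFDerivAt_iff_hasFDerivAt.2 ((hasFDerivAt_id t₀).sub_const t₀)
  have hB : HasMFDerivAt 𝓘(ℝ, ℝ) (𝓡 m) (fun t : ℝ => Circle.exp t • (Circle.exp t₀ • y))
      (t₀ - t₀) (mfderiv 𝓘(ℝ, ℝ) (𝓡 m) (fun t : ℝ => Circle.exp t • (Circle.exp t₀ • y))
        (t₀ - t₀)) :=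
    ((hγ.mdifferentiableAt (by decide)).hasMFDerivAt (x := t₀ - t₀))
  have hcomp := HasMFDerivAt.comp (f := fun t : ℝ => t - t₀) t₀ hB hA
  have heq : ((fun t : ℝ => Circle.exp t • (Circle.exp t₀ • y)) ∘ fun t : ℝ => t - t₀) =
      fun t : ℝ => Circle.exp t • y := by
    funext t
    simp only [comp_apply, smul_smul, ← Circle.exp_add, sub_add_cancel]
  rw [heq] at hcomp
  rw [hcomp.mfderiv, sub_self]
  rfl

end OrbitVelocity

section Invariance

variable {m : ℕ} {N : Type*} [TopologicalSpace N] [ChartedSpace (EuclideanSpace ℝ (Fin m)) N]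
  [MulAction Circle N] {F : Type*} [NormedAddCommGroup F] [NormedSpace ℝ F]

/-! #### The trivialisation `(u, t) ↦ exp t • param u` from the flat space `F × ℝ` -/

variable {p : N} (d : CircleSliceData (EuclideanSpace ℝ (Fin m)) F p)

/-- The trivialisation of `π` over a slice, read on the flat space `V = F × ℝ` through the
exponential: `(u, t) ↦ exp t • param u`. [folklore] -/
def sliceTrivR (x : F × ℝ) : N := Circle.exp x.2 • d.param x.1

/-- Its domain `dom × ℝ`. [folklore] -/
def sliceDomR : Set (F × ℝ) := Prod.fst ⁻¹' d.dom

/-- `dom × ℝ` is open. [folklore] -/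
theorem isOpen_sliceDomR : IsOpen (sliceDomR d) := d.isOpen_dom.preimage continuous_fst

/-- `trivR` is `C^∞` on `dom × ℝ`, for the flat model `𝓘(ℝ, F × ℝ)`. [folklore] -/
theorem contMDiffOn_sliceTrivR
    (hθ : ContMDiff ((𝓡 1).prod (𝓡 m)) (𝓡 m) ∞ (fun x : Circle × N => x.1 • x.2)) :
    ContMDiffOn 𝓘(ℝ, F × ℝ) (𝓡 m) ∞ (sliceTrivR d) (sliceDomR d) := by
  have h1 : ContMDiff 𝓘(ℝ, F × ℝ) (𝓡 1) ∞ (fun x : F × ℝ => Circle.exp x.2) := by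
    refine (contMDiff_circleExp (m := ∞)).comp ?_
    rw [contMDiff_iff_contDiff]
    exact contDiff_snd
  have h2 : ContMDiffOn 𝓘(ℝ, F × ℝ) (𝓡 m) ∞ (fun x : F × ℝ => d.param x.1) (sliceDomR d) := by
    refine d.contMDiffOn_param.comp ?_ fun x hx => hx
    rw [contMDiffOn_iff_contDiffOn]
    exact contDiff_fst.contDiffOn
  exact hθ.comp_contMDiffOn (h1.contMDiffOn.prodMk h2)

/-- **Equivariance**: `exp s • trivR (u, t) = trivR (u, t + s)`. [folklore] -/
theorem smul_sliceTrivR (s : ℝ) (x : F × ℝ) :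
    Circle.exp s • sliceTrivR d x = sliceTrivR d (x + (0, s)) := by
  simp only [sliceTrivR, Prod.snd_add, Prod.fst_add, add_zero, smul_smul, ← Circle.exp_add, add_comm]

/-- **The `t`-derivative of `trivR` is the fundamental vector field.** [folklore] -/
theorem mfderiv_sliceTrivR_inr
    (hθ : ContMDiff ((𝓡 1).prod (𝓡 m)) (𝓡 m) ∞ (fun x : Circle × N => x.1 • x.2))
    {x : F × ℝ} (hx : x ∈ sliceDomR d) :
    mfderiv 𝓘(ℝ, F × ℝ) (𝓡 m) (sliceTrivR d) x ((0, 1) : F × ℝ) =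
      circleFundVec (sliceTrivR d x) := by
  -- the line `t ↦ x + (0, t)` is mapped to the orbit `t ↦ exp (x.2 + t) • param x.1`
  have hline : HasMFDerivAt 𝓘(ℝ, ℝ) 𝓘(ℝ, F × ℝ) (fun t : ℝ => x + ((0 : F), t)) 0
      (ContinuousLinearMap.inr ℝ F ℝ) := by
    exact hasMFDerivAt_iff_hasFDerivAt.2
      (((ContinuousLinearMap.inr ℝ F ℝ).hasFDerivAt).const_add x)
  have hT : MDifferentiableAt 𝓘(ℝ, F × ℝ) (𝓡 m) (sliceTrivR d) (x + ((0 : F), (0 : ℝ))) := by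
    have : x + ((0 : F), (0 : ℝ)) = x := by simp
    rw [this]
    exact ((contMDiffOn_sliceTrivR d hθ).contMDiffAt ((isOpen_sliceDomR d).mem_nhds hx)).mdifferentiableAt
      (by simp)
  have hcomp := (HasMFDerivAt.comp (f := fun t : ℝ => x + ((0 : F), t)) 0 hT.hasMFDerivAt
    hline).mfderiv
  have hcurve : (sliceTrivR d ∘ fun t : ℝ => x + ((0 : F), t)) =
      fun t : ℝ => Circle.exp t • sliceTrivR d x := by
    funext t
    rw [comp_apply, smul_sliceTrivR d t x]
  rw [hcurve] at hcomp
  have h0 : x + ((0 : F), (0 : ℝ)) = x := by simp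
  have key := congrArg (fun L => L (1 : ℝ)) hcomp
  rw [mfderiv_circleOrbit_apply_one hθ (sliceTrivR d x) 0, Circle.exp_zero, one_smul] at key
  rw [h0] at key
  exact key.symm


/-! #### Flat forms: smoothness and closedness in the self-model -/

section Flat

variable {V : Type*} [NormedAddCommGroup V] [NormedSpace ℝ V] {k : ℕ}

/-- In the flat case the chart representative of a form is the form. [folklore] -/
theorem MForm.inChart_self (β : MForm 𝓘(ℝ, V) V ℝ k) (x : V) : β.inChart x = β := by
  funext y
  ext v
  simp [MForm.inChart_apply]
  rfl

/-- In the flat case smoothness of a form at a point is `ContDiffAt`. [folklore] -/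
theorem contDiffAt_of_smoothAt_self {β : MForm 𝓘(ℝ, V) V ℝ k} {x : V} (h : β.SmoothAt x) :
    ContDiffAt ℝ ∞ (E := V) (F := V [⋀^Fin k]→L[ℝ] ℝ) β x := by
  have h' : ContDiffWithinAt ℝ ∞ (β.inChart x) (range 𝓘(ℝ, V)) (extChartAt 𝓘(ℝ, V) x x) := h
  rw [MForm.inChart_self, modelWithCornersSelf_coe, range_id, extChartAt_self_apply] at h'
  exact h'.contDiffAt univ_mem

end Flat

/-! #### Closed horizontal forms are invariant -/

variable [IsManifold (𝓡 m) ∞ N] [T2Space N] [FiniteDimensional ℝ F]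

/-- `Fin.removeNth` on triples. [folklore] -/
private theorem removeNth_zero_three {X : Type*} (a b c : X) :
    (0 : Fin 3).removeNth ![a, b, c] = ![b, c] := by
  funext i; fin_cases i <;> rfl

/-- `Fin.removeNth` on triples. [folklore] -/
private theorem removeNth_one_three {X : Type*} (a b c : X) :
    (1 : Fin 3).removeNth ![a, b, c] = ![a, c] := by
  funext i; fin_cases i <;> rfl

/-- `Fin.removeNth` on triples. [folklore] -/
private theorem removeNth_two_three {X : Type*} (a b c : X) :
    (2 : Fin 3).removeNth ![a, b, c] = ![a, b] := by
  funext i; fin_cases i <;> rfl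

omit [IsManifold (𝓡 m) ∞ N] [T2Space N] [FiniteDimensional ℝ F] in
/-- **The pull-back of a horizontal form to the flat trivialisation is horizontal for `∂_t`.**
[folklore] -/
theorem pullback_sliceTrivR_apply_inr_left {α : MForm (𝓡 m) N ℝ 2}
    (hθ : ContMDiff ((𝓡 1).prod (𝓡 m)) (𝓡 m) ∞ (fun x : Circle × N => x.1 • x.2))
    (hhor : ∀ (n : N) (v : Fin 2 → TangentSpace (𝓡 m) n) (i : Fin 2),
      v i = circleFundVec n → α n v = 0)
    {x : F × ℝ} (hx : x ∈ sliceDomR d) (w : F × ℝ) :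
    (α.pullback 𝓘(ℝ, F × ℝ) (sliceTrivR d)) x ![((0, 1) : F × ℝ), w] = 0 := by
  rw [MForm.pullback_apply]
  apply hhor _ _ 0
  exact mfderiv_sliceTrivR_inr d hθ hx

omit [IsManifold (𝓡 m) ∞ N] [T2Space N] [FiniteDimensional ℝ F] in
/-- The same with `∂_t` in the second slot. [folklore] -/
theorem pullback_sliceTrivR_apply_inr_right {α : MForm (𝓡 m) N ℝ 2}
    (hθ : ContMDiff ((𝓡 1).prod (𝓡 m)) (𝓡 m) ∞ (fun x : Circle × N => x.1 • x.2))
    (hhor : ∀ (n : N) (v : Fin 2 → TangentSpace (𝓡 m) n) (i : Fin 2),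
      v i = circleFundVec n → α n v = 0)
    {x : F × ℝ} (hx : x ∈ sliceDomR d) (w : F × ℝ) :
    (α.pullback 𝓘(ℝ, F × ℝ) (sliceTrivR d)) x ![w, ((0, 1) : F × ℝ)] = 0 := by
  rw [MForm.pullback_apply]
  apply hhor _ _ 1
  exact mfderiv_sliceTrivR_inr d hθ hx

omit [T2Space N] [FiniteDimensional ℝ F] in
/-- The pull-back to the flat trivialisation is smooth on `dom × ℝ`. [folklore] -/
theorem smoothAt_pullback_sliceTrivR {k : ℕ} {α : MForm (𝓡 m) N ℝ k}
    (hθ : ContMDiff ((𝓡 1).prod (𝓡 m)) (𝓡 m) ∞ (fun x : Circle × N => x.1 • x.2))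
    (hsm : IsSmoothForm α) {x : F × ℝ} (hx : x ∈ sliceDomR d) :
    (α.pullback 𝓘(ℝ, F × ℝ) (sliceTrivR d)).SmoothAt x := by
  refine MForm.SmoothAt.pullback ?_ ((isSmoothForm_iff_smoothAt α).1 hsm _)
  filter_upwards [(isOpen_sliceDomR d).mem_nhds hx] with y hy
  exact (contMDiffOn_sliceTrivR d hθ).contMDiffAt ((isOpen_sliceDomR d).mem_nhds hy)

omit [T2Space N] [FiniteDimensional ℝ F] in
/-- The pull-back of a closed form to the flat trivialisation has `extDeriv = 0` on `dom × ℝ`.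
[folklore] -/
theorem extDeriv_pullback_sliceTrivR {k : ℕ} {α : MForm (𝓡 m) N ℝ k}
    (hθ : ContMDiff ((𝓡 1).prod (𝓡 m)) (𝓡 m) ∞ (fun x : Circle × N => x.1 • x.2))
    (hsm : IsSmoothForm α) (hcl : IsClosedForm α) {x : F × ℝ} (hx : x ∈ sliceDomR d) :
    extDeriv (α.pullback 𝓘(ℝ, F × ℝ) (sliceTrivR d)) x = 0 := by
  rw [← mextDeriv_eq_extDeriv]
  have hf : ∀ᶠ y in 𝓝 x, ContMDiffAt 𝓘(ℝ, F × ℝ) (𝓡 m) ∞ (sliceTrivR d) y := by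
    filter_upwards [(isOpen_sliceDomR d).mem_nhds hx] with y hy
    exact (contMDiffOn_sliceTrivR d hθ).contMDiffAt ((isOpen_sliceDomR d).mem_nhds hy)
  rw [mextDeriv_pullback_apply hf ((isSmoothForm_iff_smoothAt α).1 hsm _)]
  have h0 : mextDeriv α = 0 := hcl
  rw [h0]
  ext v
  rw [MForm.pullback_apply]
  rfl

omit [T2Space N] [FiniteDimensional ℝ F] in
/-- **`∂_t` of the coefficients of the pull-back of a closed horizontal `2`-form vanishes**:
`dβ(∂_t, w₁, w₂) = ∂_t β(w₁, w₂) - ∂_{w₁} β(∂_t, w₂) + ∂_{w₂} β(∂_t, w₁)` and the last two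
coefficients are identically zero. (The pull-back `β` is read as a map of the flat space
`F × ℝ` into `2`-forms.) [folklore] -/
theorem fderiv_pullback_sliceTrivR_apply_inr {α : MForm (𝓡 m) N ℝ 2}
    (hθ : ContMDiff ((𝓡 1).prod (𝓡 m)) (𝓡 m) ∞ (fun x : Circle × N => x.1 • x.2))
    (hsm : IsSmoothForm α) (hcl : IsClosedForm α)
    (hhor : ∀ (n : N) (v : Fin 2 → TangentSpace (𝓡 m) n) (i : Fin 2),
      v i = circleFundVec n → α n v = 0)
    {x : F × ℝ} (hx : x ∈ sliceDomR d) (w₁ w₂ : F × ℝ) :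
    fderiv ℝ (fun y => (show (F × ℝ) → (F × ℝ) [⋀^Fin 2]→L[ℝ] ℝ from
      α.pullback 𝓘(ℝ, F × ℝ) (sliceTrivR d)) y ![w₁, w₂]) x ((0, 1) : F × ℝ) = 0 := by
  set β := (show (F × ℝ) → (F × ℝ) [⋀^Fin 2]→L[ℝ] ℝ from
    α.pullback 𝓘(ℝ, F × ℝ) (sliceTrivR d)) with hβ
  have hdiff : DifferentiableAt ℝ β x :=
    (contDiffAt_of_smoothAt_self (smoothAt_pullback_sliceTrivR d hθ hsm hx)).differentiableAt
      (by simp)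
  have hd : extDeriv β x = 0 := extDeriv_pullback_sliceTrivR d hθ hsm hcl hx
  have happ := congrArg (fun γ : (F × ℝ) [⋀^Fin 3]→L[ℝ] ℝ => γ ![((0, 1) : F × ℝ), w₁, w₂]) hd
  simp only [ContinuousAlternatingMap.coe_zero, Pi.zero_apply] at happ
  rw [extDeriv_apply hdiff, Fin.sum_univ_three] at happ
  simp only [Fin.val_zero, pow_zero, one_smul, Fin.val_one, pow_one, neg_smul, Fin.val_two,
    Matrix.cons_val_zero, Matrix.cons_val_one, Matrix.cons_val] at happ
  rw [removeNth_zero_three, removeNth_one_three, removeNth_two_three] at happ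
  -- the two coefficients with a `∂_t` slot vanish identically near `x`
  have h1 : fderiv ℝ (fun y => β y ![((0, 1) : F × ℝ), w₂]) x = 0 := by
    have hev : (fun y => β y ![((0, 1) : F × ℝ), w₂]) =ᶠ[𝓝 x] fun _ => (0 : ℝ) := by
      filter_upwards [(isOpen_sliceDomR d).mem_nhds hx] with y hy
      exact pullback_sliceTrivR_apply_inr_left d hθ hhor hy w₂
    rw [hev.fderiv_eq, fderiv_const_apply]
  have h2 : fderiv ℝ (fun y => β y ![((0, 1) : F × ℝ), w₁]) x = 0 := by
    have hev : (fun y => β y ![((0, 1) : F × ℝ), w₁]) =ᶠ[𝓝 x] fun _ => (0 : ℝ) := by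
      filter_upwards [(isOpen_sliceDomR d).mem_nhds hx] with y hy
      exact pullback_sliceTrivR_apply_inr_left d hθ hhor hy w₁
    rw [hev.fderiv_eq, fderiv_const_apply]
  rw [h1, h2] at happ
  simpa using happ

omit [T2Space N] [FiniteDimensional ℝ F] in
/-- **The coefficients of the pull-back of a closed horizontal `2`-form do not depend on `t`.**
[folklore] -/
theorem pullback_sliceTrivR_apply_eq {α : MForm (𝓡 m) N ℝ 2}
    (hθ : ContMDiff ((𝓡 1).prod (𝓡 m)) (𝓡 m) ∞ (fun x : Circle × N => x.1 • x.2))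
    (hsm : IsSmoothForm α) (hcl : IsClosedForm α)
    (hhor : ∀ (n : N) (v : Fin 2 → TangentSpace (𝓡 m) n) (i : Fin 2),
      v i = circleFundVec n → α n v = 0)
    {u : F} (hu : u ∈ d.dom) (t t' : ℝ) (w : Fin 2 → F × ℝ) :
    (α.pullback 𝓘(ℝ, F × ℝ) (sliceTrivR d)) (u, t) w =
      (α.pullback 𝓘(ℝ, F × ℝ) (sliceTrivR d)) (u, t') w := by
  set β := (show (F × ℝ) → (F × ℝ) [⋀^Fin 2]→L[ℝ] ℝ from
    α.pullback 𝓘(ℝ, F × ℝ) (sliceTrivR d)) with hβ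
  have hw : w = ![w 0, w 1] := by
    funext i; fin_cases i <;> rfl
  set g : ℝ → ℝ := fun s => β (u, s) ![w 0, w 1] with hg
  have hline : ∀ s : ℝ, HasFDerivAt (fun s : ℝ => ((u, s) : F × ℝ))
      (ContinuousLinearMap.inr ℝ F ℝ) s := by
    intro s
    have h := ((ContinuousLinearMap.inr ℝ F ℝ).hasFDerivAt (x := s)).const_add (u, (0 : ℝ))
    refine h.congr_of_eventuallyEq (Filter.Eventually.of_forall fun s' => ?_)
    simp
  have hmem : ∀ s : ℝ, ((u, s) : F × ℝ) ∈ sliceDomR d := fun s => hu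
  have hG : ∀ s : ℝ, DifferentiableAt ℝ (fun y : F × ℝ => β y ![w 0, w 1]) (u, s) := by
    intro s
    have hdiff : DifferentiableAt ℝ β (u, s) :=
      (contDiffAt_of_smoothAt_self
        (smoothAt_pullback_sliceTrivR d hθ hsm (hmem s))).differentiableAt (by simp)
    exact hdiff.continuousAlternatingMap_apply_const ![w 0, w 1]
  have hderiv : ∀ s : ℝ, HasDerivAt g 0 s := by
    intro s
    have hc := (hG s).hasFDerivAt.comp s (hline s)
    have hc' : HasDerivAt g ((fderiv ℝ (fun y : F × ℝ => β y ![w 0, w 1]) (u, s))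
        (((0 : F), (1 : ℝ)) : F × ℝ)) s := hc.hasDerivAt
    rw [fderiv_pullback_sliceTrivR_apply_inr d hθ hsm hcl hhor (hmem s)] at hc'
    exact hc'
  have hconst := is_const_of_deriv_eq_zero (fun s => (hderiv s).differentiableAt)
    (fun s => (hderiv s).deriv) t t'
  rw [hw]
  exact hconst

/-! #### The local section of the flat trivialisation and the invariance -/

/-- The flat trivialisation at the slice point `(u, t)` followed by translation: the section
`y ↦ (coord (exp (-t) • y), t + angle (exp (-t) • y))` on the translate `exp t • T` of the tube.
[folklore] -/
def sliceSecR (t : ℝ) (y : N) : F × ℝ :=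
  (d.coord ((Circle.exp t)⁻¹ • y), t + d.angle ((Circle.exp t)⁻¹ • y))

omit [IsManifold (𝓡 m) ∞ N] [T2Space N] [FiniteDimensional ℝ F] in
/-- `sliceTrivR ∘ sliceSecR t = id` on the translate `exp t • T` of the tube. [folklore] -/
theorem sliceTrivR_sliceSecR (t : ℝ) {y : N} (hy : (Circle.exp t)⁻¹ • y ∈ d.T) :
    sliceTrivR d (sliceSecR d t y) = y := by
  simp only [sliceTrivR, sliceSecR]
  rw [Circle.exp_add, mul_smul, d.exp_angle_smul_param_coord hy, smul_inv_smul]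

omit [IsManifold (𝓡 m) ∞ N] [T2Space N] [FiniteDimensional ℝ F] in
/-- The section at the slice point: `sliceSecR t (exp t • param u) = (u, t)`. [folklore] -/
theorem sliceSecR_sliceTrivR {u : F} (hu : u ∈ d.dom) (t : ℝ) :
    sliceSecR d t (sliceTrivR d (u, t)) = (u, t) := by
  simp only [sliceTrivR, sliceSecR, inv_smul_smul]
  have hc : d.coord (d.param u) = u := d.coord_param hu
  have ha : d.angle (d.param u) = 0 := by
    simp only [CircleSliceData.angle, CircleSliceData.param]
    rw [d.ψ.right_inv (d.param_mem hu).1, add_sub_cancel_left]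
    exact d.apply_coe_symm u
  rw [hc, ha, add_zero]

omit [IsManifold (𝓡 m) ∞ N] [T2Space N] [FiniteDimensional ℝ F] in
/-- The section is `C^∞` on the translate of the tube. [folklore] -/
theorem contMDiffOn_sliceSecR
    (hθ : ContMDiff ((𝓡 1).prod (𝓡 m)) (𝓡 m) ∞ (fun x : Circle × N => x.1 • x.2)) (t : ℝ) :
    ContMDiffOn (𝓡 m) 𝓘(ℝ, F × ℝ) ∞ (sliceSecR d t) {y : N | (Circle.exp t)⁻¹ • y ∈ d.T} := by
  have hs : ContMDiff (𝓡 m) (𝓡 m) ∞ (fun y : N => (Circle.exp t)⁻¹ • y) :=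
    hθ.comp (contMDiff_const.prodMk contMDiff_id)
  refine ContMDiffOn.prodMk_space ?_ ?_
  · exact d.contMDiffOn_coord.comp hs.contMDiffOn fun y hy => hy
  · have hang : ContMDiffOn (𝓡 m) 𝓘(ℝ, ℝ) ∞ (fun y : N => d.angle ((Circle.exp t)⁻¹ • y))
        {y : N | (Circle.exp t)⁻¹ • y ∈ d.T} :=
      d.contMDiffOn_angle.comp hs.contMDiffOn fun y hy => hy
    exact contMDiffOn_const.add hang

omit [T2Space N] [FiniteDimensional ℝ F] in
/-- **Closed horizontal forms are invariant along the orbits through a slice**: for `x₀ ∈ dom × ℝ`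
and tangent vectors `v` at `n₀ = sliceTrivR x₀`,
`α (exp s • n₀) (d(exp s • ·) v) = α n₀ v`. [cite: CannasdasilvaGuilleminPires2010, Def. 2.2] -/
theorem apply_smul_sliceTrivR_eq {α : MForm (𝓡 m) N ℝ 2}
    (hθ : ContMDiff ((𝓡 1).prod (𝓡 m)) (𝓡 m) ∞ (fun x : Circle × N => x.1 • x.2))
    (hsm : IsSmoothForm α) (hcl : IsClosedForm α)
    (hhor : ∀ (n : N) (v : Fin 2 → TangentSpace (𝓡 m) n) (i : Fin 2),
      v i = circleFundVec n → α n v = 0)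
    {u : F} (hu : u ∈ d.dom) (t s : ℝ)
    (v : Fin 2 → TangentSpace (𝓡 m) ((sliceTrivR d) (u, t))) :
    α (Circle.exp s • (sliceTrivR d) (u, t))
      (fun i => mfderiv (𝓡 m) (𝓡 m) (fun y : N => Circle.exp s • y) ((sliceTrivR d) (u, t)) (v i)) =
      α ((sliceTrivR d) (u, t)) v := by
  haveI : ContinuousSMul Circle N := ⟨hθ.continuous⟩
  have hx₀D : ((u, t) : F × ℝ) ∈ sliceDomR d := hu
  have hmemT : (Circle.exp t)⁻¹ • (sliceTrivR d) (u, t) ∈ d.T := by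
    show (Circle.exp t)⁻¹ • (Circle.exp t • d.param u) ∈ d.T
    rw [inv_smul_smul]
    exact (d.param_mem hu).2
  have hO : {y : N | (Circle.exp t)⁻¹ • y ∈ d.T} ∈ 𝓝 ((sliceTrivR d) (u, t)) :=
    (d.hTo.preimage (continuous_const_smul _)).mem_nhds hmemT
  have hσn₀ : (sliceSecR d t) ((sliceTrivR d) (u, t)) = (u, t) := sliceSecR_sliceTrivR d hu t
  -- differentiability
  have hTd : ∀ x ∈ sliceDomR d, MDifferentiableAt 𝓘(ℝ, F × ℝ) (𝓡 m) (sliceTrivR d) x := fun x hx =>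
    ((contMDiffOn_sliceTrivR d hθ).contMDiffAt ((isOpen_sliceDomR d).mem_nhds hx)).mdifferentiableAt
      (by simp)
  have hσd : MDifferentiableAt (𝓡 m) 𝓘(ℝ, F × ℝ) (sliceSecR d t) ((sliceTrivR d) (u, t)) :=
    ((contMDiffOn_sliceSecR d hθ t).contMDiffAt hO).mdifferentiableAt (by simp)
  -- `dT ∘ dσ = id` at `((sliceTrivR d) (u, t))`
  have hid : ∀ w : TangentSpace (𝓡 m) ((sliceTrivR d) (u, t)),
      mfderiv 𝓘(ℝ, F × ℝ) (𝓡 m) (sliceTrivR d) (u, t) (mfderiv (𝓡 m) 𝓘(ℝ, F × ℝ) (sliceSecR d t) ((sliceTrivR d) (u, t)) w) = w := by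
    intro w
    have hTσ : MDifferentiableAt 𝓘(ℝ, F × ℝ) (𝓡 m) (sliceTrivR d) ((sliceSecR d t) ((sliceTrivR d) (u, t))) := by rw [hσn₀]; exact hTd (u, t) hx₀D
    have hc := hTσ.hasMFDerivAt.comp ((sliceTrivR d) (u, t)) hσd.hasMFDerivAt
    have hloc : ((sliceTrivR d) ∘ (sliceSecR d t)) =ᶠ[𝓝 ((sliceTrivR d) (u, t))] id := by
      filter_upwards [hO] with y hy
      exact sliceTrivR_sliceSecR d t hy
    have hc' := hc.congr_of_eventuallyEq hloc.symm
    have heq := hc'.mfderiv.symm.trans (hasMFDerivAt_id (I := 𝓡 m) ((sliceTrivR d) (u, t))).mfderiv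
    rw [hσn₀] at heq
    exact congrArg (fun L => L w) heq
  -- `d(exp s • ·) ∘ dT_{((u, t) : F × ℝ)} = dT_{((u, t) : F × ℝ) + (0, s)}`
  have hequi : ∀ w : F × ℝ,
      mfderiv (𝓡 m) (𝓡 m) (fun y : N => Circle.exp s • y) ((sliceTrivR d) (u, t)) (mfderiv 𝓘(ℝ, F × ℝ) (𝓡 m) (sliceTrivR d) (u, t) w) =
        mfderiv 𝓘(ℝ, F × ℝ) (𝓡 m) (sliceTrivR d) (((u, t) : F × ℝ) + ((0 : F), s)) w := by
    intro w
    have hsm' : ContMDiff (𝓡 m) (𝓡 m) ∞ (fun y : N => Circle.exp s • y) :=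
      hθ.comp (contMDiff_const.prodMk contMDiff_id)
    have hA := (hsm'.mdifferentiableAt (x := ((sliceTrivR d) (u, t))) (by simp)).hasMFDerivAt.comp ((u, t) : F × ℝ)
      (hTd (u, t) hx₀D).hasMFDerivAt
    have hx₁D : ((u, t) : F × ℝ) + ((0 : F), s) ∈ sliceDomR d := by
      show (((u, t) : F × ℝ) + ((0 : F), s)).1 ∈ d.dom
      simpa using hu
    have hτ : HasMFDerivAt 𝓘(ℝ, F × ℝ) 𝓘(ℝ, F × ℝ) (fun x : F × ℝ => x + ((0 : F), s)) ((u, t) : F × ℝ)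
        (ContinuousLinearMap.id ℝ (F × ℝ)) :=
      hasMFDerivAt_iff_hasFDerivAt.2 ((hasFDerivAt_id ((u, t) : F × ℝ)).add_const _)
    have hB := HasMFDerivAt.comp (f := fun x : F × ℝ => x + ((0 : F), s)) ((u, t) : F × ℝ)
      (hTd _ hx₁D).hasMFDerivAt hτ
    have hfun : ((fun y : N => Circle.exp s • y) ∘ (sliceTrivR d)) = ((sliceTrivR d) ∘ fun x : F × ℝ => x + ((0 : F), s)) := by
      funext x
      exact smul_sliceTrivR d s x
    rw [hfun] at hA
    have heq := hA.mfderiv.symm.trans hB.mfderiv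
    exact congrArg (fun L => L w) heq
  -- transport of `α` along equal base points
  have transport : ∀ {p q : N} (_ : p = q) (w : Fin 2 → EuclideanSpace ℝ (Fin m)),
      α p w = α q w := by
    intro p q h w; subst h; rfl
  -- the computation
  set vt : Fin 2 → F × ℝ := fun i => mfderiv (𝓡 m) 𝓘(ℝ, F × ℝ) (sliceSecR d t) ((sliceTrivR d) (u, t)) (v i) with hvt
  have hv : ∀ i, mfderiv 𝓘(ℝ, F × ℝ) (𝓡 m) (sliceTrivR d) (u, t) (vt i) = v i := fun i => hid (v i)
  have step1 : (fun i => mfderiv (𝓡 m) (𝓡 m) (fun y : N => Circle.exp s • y) ((sliceTrivR d) (u, t)) (v i)) =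
      fun i => (mfderiv 𝓘(ℝ, F × ℝ) (𝓡 m) (sliceTrivR d) (((u, t) : F × ℝ) + ((0 : F), s)) (vt i) :
        EuclideanSpace ℝ (Fin m)) := by
    funext i
    rw [← hequi (vt i), hv i]
  have step2 : α (Circle.exp s • ((sliceTrivR d) (u, t)))
      (fun i => mfderiv 𝓘(ℝ, F × ℝ) (𝓡 m) (sliceTrivR d) (((u, t) : F × ℝ) + ((0 : F), s)) (vt i)) =
      (α.pullback 𝓘(ℝ, F × ℝ) (sliceTrivR d)) (((u, t) : F × ℝ) + ((0 : F), s)) vt := by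
    rw [MForm.pullback_apply]
    exact transport (smul_sliceTrivR d s (u, t)) _
  have step3 : (α.pullback 𝓘(ℝ, F × ℝ) (sliceTrivR d)) (((u, t) : F × ℝ) + ((0 : F), s)) vt =
      (α.pullback 𝓘(ℝ, F × ℝ) (sliceTrivR d)) ((u, t) : F × ℝ) vt := by
    have h1 : ((u, t) : F × ℝ) + ((0 : F), s) = (u, t + s) := by simp
    rw [h1]
    exact pullback_sliceTrivR_apply_eq d hθ hsm hcl hhor hu (t + s) t vt
  have step4 : (α.pullback 𝓘(ℝ, F × ℝ) (sliceTrivR d)) ((u, t) : F × ℝ) vt = α ((sliceTrivR d) (u, t)) v := by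
    rw [MForm.pullback_apply]
    congr 1
    funext i
    exact hv i
  calc α (Circle.exp s • ((sliceTrivR d) (u, t)))
        (fun i => mfderiv (𝓡 m) (𝓡 m) (fun y : N => Circle.exp s • y) ((sliceTrivR d) (u, t)) (v i))
      = α (Circle.exp s • ((sliceTrivR d) (u, t)))
          (fun i => mfderiv 𝓘(ℝ, F × ℝ) (𝓡 m) (sliceTrivR d) (((u, t) : F × ℝ) + ((0 : F), s)) (vt i)) := by rw [step1]
    _ = (α.pullback 𝓘(ℝ, F × ℝ) (sliceTrivR d)) (((u, t) : F × ℝ) + ((0 : F), s)) vt := step2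
    _ = (α.pullback 𝓘(ℝ, F × ℝ) (sliceTrivR d)) ((u, t) : F × ℝ) vt := step3
    _ = α ((sliceTrivR d) (u, t)) v := step4

/-- **A closed smooth horizontal `2`-form is basic** (invariant under the free smooth circle
action): `ℒ_X α = ι_X dα + d ι_X α = 0`, here obtained without Cartan's formula — in the flat
trivialisation `(u, t) ↦ exp t • param u` of a slice the pull-back of `α` has no `dt`-component
and `t`-independent coefficients (`fderiv_pullback_sliceTrivR_apply_inr`), and every point lies
over a slice. For the null fibration of an origami form: `i*ω` is basic, so that it descends to
`B` (Cannas da Silva–Guillemin–Pires, proof of Prop. 2.8: "`i*ω = π*ω_B`").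
[cite: CannasdasilvaGuilleminPires2010, Def. 2.2] -/
theorem isCircleBasicForm_of_horizontal {α : MForm (𝓡 m) N ℝ 2}
    (hθ : ContMDiff ((𝓡 1).prod (𝓡 m)) (𝓡 m) ∞ (fun x : Circle × N => x.1 • x.2))
    (hfree : ∀ (a : Circle) (x : N), a • x = x → a = 1)
    (hF : Module.finrank ℝ F + 1 = m)
    (hsm : IsSmoothForm α) (hcl : IsClosedForm α)
    (hhor : ∀ (n : N) (v : Fin 2 → TangentSpace (𝓡 m) n) (i : Fin 2),
      v i = circleFundVec n → α n v = 0) :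
    IsCircleBasicForm α := by
  haveI : ContinuousSMul Circle N := ⟨hθ.continuous⟩
  refine ⟨fun a n v => ?_, hhor⟩
  letI := circleQuotientChartedSpace F hθ hfree hF
  -- the slice at the chosen representative of the orbit of `n`
  set p : N := (circleQuotientMk n : CircleQuotient N).out with hp
  set d : CircleSliceData (EuclideanSpace ℝ (Fin m)) F p := circleSliceDataAt hθ hfree hF p
    with hd
  have hn : n ∈ circleQuotientMk ⁻¹' d.chart.source := by
    rw [mem_preimage, d.chart_source]
    have hpn : circleQuotientMk p = circleQuotientMk n := Quotient.out_eq _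
    rw [← hpn]
    exact ⟨p, d.hpT, rfl⟩
  obtain ⟨a₀, ha₀⟩ := d.exists_inv_smul_mem_T hn
  obtain ⟨t, rfl⟩ := Circle.exp_surjective a₀
  obtain ⟨s, rfl⟩ := Circle.exp_surjective a
  -- `n = sliceTrivR d (u, t)` with `u = coord (exp (-t) • n)`
  set u : F := d.coord ((Circle.exp t)⁻¹ • n) with hu
  have huD : u ∈ d.dom := d.coord_mem_dom ha₀
  have hn₀ : sliceTrivR d (u, t + d.angle ((Circle.exp t)⁻¹ • n)) = n :=
    sliceTrivR_sliceSecR d t ha₀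
  have key := apply_smul_sliceTrivR_eq d hθ hsm hcl hhor huD (t + d.angle ((Circle.exp t)⁻¹ • n)) s
  -- transport from `sliceTrivR d (u, t)` to `n`
  have transfer : ∀ {q q' : N} (_ : q = q'),
      (∀ w : Fin 2 → TangentSpace (𝓡 m) q,
        α (Circle.exp s • q)
          (fun i => mfderiv (𝓡 m) (𝓡 m) (fun y : N => Circle.exp s • y) q (w i)) = α q w) →
      ∀ w : Fin 2 → TangentSpace (𝓡 m) q',
        α (Circle.exp s • q')
          (fun i => mfderiv (𝓡 m) (𝓡 m) (fun y : N => Circle.exp s • y) q' (w i)) = α q' w := by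
    intro q q' h hq; subst h; exact hq
  exact transfer hn₀ key v

end Invariance

end Literature.Geometry.Symplectic

end
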